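import Summits.Parity.GeneralizedHardyLittlewood.Theorems.LeeYangFibresAssembly
import Summits.Parity.GeneralizedHardyLittlewood.Theorems.LeeYangFibresRelativeDimOneFloatingCalibrationFree
import HarnessLib

/-!
# Crux `RelativeDimOne` (stmt-Parity-14113) — STRATEGY SPLIT certificate (crux-strategist s1, 2026-08-17)

The route-level DECOMPOSITION of the node, kernel-checked BY NAME from landed theorems only
(no `sorry`, no literature debt):

* `RelativeDimOne_of_mechanism : CellParityLaw → FibreHyperbolicity → RelativeDimOne` — the node is FED by the
  route's two ranked mechanism cruxes (stmt-Parity-14109 rank 3, stmt-Parity-14108 rank 2) through the PROVED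
  supports `modelCellFacts_proof` (14111), `HyperbolicityClipsParity_proof` (14114),
  `LeeYangFibresCells.cellsToRelativeDimOne_proof` (14115). This is the typed split `Sub₁ → Sub₂ → Crux` of the
  strategist census §Decomposition; it is NOT filed with `route edit --split` (the children are existing TOP-LEVEL
  cruxes with their own foreseen tenure splits — a `--split` would push them to layer 2 and forbid those) and NOT
  registered as a line (its stubs would be the two items verbatim: duplicate staffing of their crux chains).
* `noSiegelZeros_of_mechanism`, `not_mechanism_of_unboundedSiegelZeros` — both halves together inherit the node's
  Siegel-sensitivity (debt-free necessity `noSiegelZeros_of_relativeDimOne'`).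
* `relativeDimOne_iff_of_mechanism_and_upgradeFree` — sanity: with the mechanism in hand the node needs nothing else.
-/

namespace Summit.Parity.GeneralizedHardyLittlewood.Cruxes.RelativeDimOne.MechanismSplit

open Literature.Barriers.Parity (UnboundedSiegelZeros)
open Literature.NumberTheory.LFunctions (NoSiegelZeros)
open Summit.Parity.GeneralizedHardyLittlewood.Theses.LeeYangFibres
  (RelativeDimOne CellParityLaw FibreHyperbolicity PrimeCellsRelative)
open Summit.Parity.GeneralizedHardyLittlewood.Theorems (modelCellFacts_proof HyperbolicityClipsParity_proof)
open Summit.Parity.GeneralizedHardyLittlewood.Theorems.LeeYangFibresCells (cellsToRelativeDimOne_proof)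
open Summit.Parity.GeneralizedHardyLittlewood.Cruxes.RelativeDimOne.FloatingLevelCore
  (noSiegelZeros_of_relativeDimOne' not_relativeDimOne_of_unboundedSiegelZeros')

/-- The cell-level output of the mechanism: `CellParityLaw → FibreHyperbolicity → PrimeCellsRelative`
(clipping lemma with the proved model-cell facts). -/
theorem PrimeCellsRelative_of_mechanism (hL : CellParityLaw) (hH : FibreHyperbolicity) : PrimeCellsRelative :=
  HyperbolicityClipsParity_proof hL hH modelCellFacts_proof

/-- **The typed split of the node** (`Sub₁ → Sub₂ → Crux`, glue PROVED):
`CellParityLaw → FibreHyperbolicity → RelativeDimOne`. -/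
theorem RelativeDimOne_of_mechanism (hL : CellParityLaw) (hH : FibreHyperbolicity) : RelativeDimOne :=
  cellsToRelativeDimOne_proof (PrimeCellsRelative_of_mechanism hL hH)

/-- The same, uncurried as an implication between the route's Props. -/
theorem RelativeDimOne_of_subs : CellParityLaw → FibreHyperbolicity → RelativeDimOne :=
  fun hL hH => RelativeDimOne_of_mechanism hL hH

/-- The mechanism proves rh.S34 (no Siegel zeros), unconditionally. -/
theorem noSiegelZeros_of_mechanism (hL : CellParityLaw) (hH : FibreHyperbolicity) : NoSiegelZeros :=
  noSiegelZeros_of_relativeDimOne' (RelativeDimOne_of_mechanism hL hH)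

/-- Siegel zeros of unbounded quality refute the conjunction of the two mechanism cruxes. -/
theorem not_mechanism_of_unboundedSiegelZeros (hU : UnboundedSiegelZeros) :
    ¬ (CellParityLaw ∧ FibreHyperbolicity) :=
  fun h => not_relativeDimOne_of_unboundedSiegelZeros' hU (RelativeDimOne_of_mechanism h.1 h.2)

end Summit.Parity.GeneralizedHardyLittlewood.Cruxes.RelativeDimOne.MechanismSplit
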